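import Summits.ResolutionOfSingularities.ResolutionOfSingularities.Theorems.LogCanQuotLU.Negative.PlaneWitness
import HarnessLib

/-!
# `LogCanQuotLU` — negative lemmas, part VIII: the multiplicative eigenvalue `u` cannot be
# normalised to `1` by a unit of `S'_c` (the twisted `μ₃`-point of the rotation field)

Support (negative) lemma for crux `stmt-ResolutionOfSingularities-17082`
(`Summit.ResolutionOfSingularities.ResolutionOfSingularities.Theses.FoliationDescent.LogCanQuotLU`,
route `FoliationDescent`, crux #3), filed by the standing disprover (cdisprove gen 2; work file
`Cruxes/LogCanQuotLU/Disproof.lean` §6). This file declares NO definition and NO declaration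
concludes the route decl positively.

In the multiplicative case of the crux, `δ = g•D` preserves `B = S'_c` and `δ^p = u·δ` with `u` a
unit of `B` (automatically a `δ`-constant, `Cruxes/LogCanQuotLU/Disproof.lean` §5.8). The printed
normal form (Rudakov–Shafarevich; Posva, arXiv:2311.16694 Prop. 11–12) is stated for a genuine
`μ_p`-ACTION `δ^p = δ`, reached from `δ^p = uδ` by the rescaling `δ ↦ u^{-1/(p-1)}δ` — available
only after adjoining a `(p-1)`-th root of `u` (finite étale). `multiplicative_unit_normalisation_false`
shows that this étale extension cannot be avoided in general: the natural strengthening "some unit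
`h` of `S'_c` already gives `((hg)•D)^p = (hg)•D`" is FALSE.

WITNESS: `p = 3`, `k = 𝔽₃`, `K = 𝔽₃(X₀, X₁)`, `S' = 𝔽₃[X₀, X₁]`, `O` dominating the origin
(part V), the ROTATION field `D = -X₁∂₀ + X₀∂₁` (`D³ = -D`: multiplicative with `u = -1`,
singular at the origin; its constants `𝔽₃[X₀³, X₁³, X₀² + X₁²]` are a NON-SPLIT `A₂` point),
`g = 1`. If `h = α/β` (`α(0)β(0) ≠ 0`) had `(hD)³ = hD`, evaluating at `X₁` gives
`(Dh)² + h·D²h - h² = 1` (`3 = 0` kills the cross term); clearing denominators,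
`(βα' - αβ')² + α(β(βα'' - αβ'') - 2β'(βα' - αβ')) - α²β² - β⁴ = 0` in `𝔽₃[X₀, X₁]`, where
`'` is the rotation field, which maps into the ideal `(X₀, X₁)`; taking constant terms,
`-α(0)²β(0)² - β(0)⁴ = 0`, i.e. `ᾱ² = -1` for the unit residue `ᾱ = α(0)/β(0) ∈ 𝔽₃^×` —
impossible. (So the twisted form `G_{-1}` of `μ₃` splits over `S'_c[i]`, `i² = -1`, not over
`S'_c`: a proof of `stub_multiplicativeToricLU` must handle the Galois twist over the residue
field itself, or descend from the étale extension.)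

## Sources
* A. N. Rudakov, I. R. Shafarevich, Inseparable morphisms of algebraic surfaces (1976), §1, Thm. 1
  and the normal form of multiplicative points. [RudakovShafarevich1976]
* N. Jacobson, *Lectures in Abstract Algebra* III (1964), Ch. IV §8 (Hochschild's formula
  `(hD)^p = h^p D^p + (hD)^{p-1}(h)·D`). [folklore computation here, `p = 3`]
-/

noncomputable section

set_option linter.dupNamespace false -- mandated namespace of this single-conjunct summit

open IsLocalRing MvPolynomial
open Literature.AlgebraicGeometry.Resolution

namespace Summit.ResolutionOfSingularities.ResolutionOfSingularities.Theorems.LogCanQuotLU.Negative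

/-- In characteristic `3` the cube `Δ ∘ Δ ∘ Δ` of a derivation is a derivation. [folklore] -/
theorem exists_derivation_comp_self_three {k F : Type} [Field k] [Field F] [Algebra k F] [CharP F 3]
    (Δ : Derivation k F F) : ∃ Δ₃ : Derivation k F F, ∀ x, Δ₃ x = Δ (Δ (Δ x)) := by
  have h3 : (3 : F) = 0 := by exact_mod_cast CharP.cast_eq_zero F 3
  exact ⟨{ toLinearMap := (Δ : F →ₗ[k] F).comp ((Δ : F →ₗ[k] F).comp (Δ : F →ₗ[k] F))
           map_one_eq_zero' := by simp
           leibniz' := fun a b => by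
             simp only [LinearMap.coe_comp, Function.comp_apply, Derivation.coeFn_coe,
               Derivation.leibniz, map_add, smul_eq_mul]
             linear_combination (Δ a * Δ (Δ b) + Δ (Δ a) * Δ b) * h3 }, fun _ => rfl⟩

/-- **The rotation field** `D = -X₁∂₀ + X₀∂₁` of `k(X₀, X₁)` in characteristic `3`: it restricts
to `k[X₀, X₁]`, `D X₀ = -X₁`, `D X₁ = X₀`, and `D ∘ D ∘ D = -D` (multiplicative with `u = -1`).
[folklore] -/
theorem exists_rotationDerivation_plane {k : Type} [Field k] [CharP k 3] :
    ∃ D : Derivation k (FractionRing (MvPolynomial (Fin 2) k))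
        (FractionRing (MvPolynomial (Fin 2) k)),
      (∀ a : MvPolynomial (Fin 2) k, D (algebraMap (MvPolynomial (Fin 2) k) _ a) =
        algebraMap (MvPolynomial (Fin 2) k) _ (-(X 1 * pderiv 0 a) + X 0 * pderiv 1 a)) ∧
      D (algebraMap (MvPolynomial (Fin 2) k) _ (X 0)) =
        -algebraMap (MvPolynomial (Fin 2) k) _ (X 1) ∧
      D (algebraMap (MvPolynomial (Fin 2) k) _ (X 1)) =
        algebraMap (MvPolynomial (Fin 2) k) _ (X 0) ∧
      ∀ x, D (D (D x)) = -D x := by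
  classical
  let A : Type := MvPolynomial (Fin 2) k
  let K : Type := FractionRing A
  haveI : CharP K 3 := charP_of_injective_algebraMap (algebraMap k K).injective 3
  obtain ⟨D₀, hD₀⟩ :=
    exists_derivation_extend_of_isLocalization k K (nonZeroDivisors A) (pderiv 0 : Derivation k A A)
  obtain ⟨D₁, hD₁⟩ :=
    exists_derivation_extend_of_isLocalization k K (nonZeroDivisors A) (pderiv 1 : Derivation k A A)
  let D : Derivation k K K := (-algebraMap A K (X 1)) • D₀ + algebraMap A K (X 0) • D₁
  have hD : ∀ a : A, D (algebraMap A K a) =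
      algebraMap A K (-(X 1 * pderiv 0 a) + X 0 * pderiv 1 a) := by
    intro a
    simp only [D, Derivation.add_apply, Derivation.smul_apply, smul_eq_mul, hD₀, hD₁, map_add,
      map_mul, map_neg]
    ring
  have hDX0 : D (algebraMap A K (X 0)) = -algebraMap A K (X 1) := by
    rw [hD, pderiv_X_self, pderiv_X_of_ne (by decide), mul_one, mul_zero, add_zero, map_neg]
  have hDX1 : D (algebraMap A K (X 1)) = algebraMap A K (X 0) := by
    rw [hD, pderiv_X_of_ne (by decide), pderiv_X_self, mul_one, mul_zero, neg_zero, zero_add]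
  obtain ⟨D₃, hD₃⟩ := exists_derivation_comp_self_three D
  have hDDD : D₃ = -D := derivation_eq_of_apply_X_eq D₃ (-D) fun i => by
    fin_cases i
    · show D₃ (algebraMap A K (X 0)) = (-D) (algebraMap A K (X 0))
      rw [hD₃, hDX0, map_neg, hDX1, map_neg, hDX0, Derivation.neg_apply, hDX0]
    · show D₃ (algebraMap A K (X 1)) = (-D) (algebraMap A K (X 1))
      rw [hD₃, hDX1, hDX0, map_neg, hDX1, Derivation.neg_apply, hDX1]
  exact ⟨D, hD, hDX0, hDX1, fun x => by rw [← hD₃, hDDD, Derivation.neg_apply]⟩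

/-- **The rescaling identity in characteristic `3`.** If `D x = -y`, `D y = x` and the rescaled
field `(a/b)•D` is idempotent at `y`, `((a/b)D)³ y = ((a/b)D) y`, then — by Hochschild's formula
for `p = 3`, `(hD)³ = h³D³ + ((hD)²h)·D`, here expanded by hand — `(Dh)² + h·D²h - h² = 1` for
`h = a/b`, i.e. after clearing the denominator `b⁴`:
`(b·Da - a·Db)² + a·(b·(b·D²a - a·D²b) - 2·Db·(b·Da - a·Db)) - a²b² - b⁴ = 0`. [folklore] -/
theorem rescaling_identity_char_three {k F : Type} [Field k] [Field F] [Algebra k F] [CharP F 3]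
    (D : Derivation k F F) {x y a b : F} (hx : D x = -y) (hy : D y = x) (hx0 : x ≠ 0)
    (ha0 : a ≠ 0) (hb0 : b ≠ 0)
    (hidem : ((a / b) • D) (((a / b) • D) (((a / b) • D) y)) = ((a / b) • D) y) :
    (b * D a - a * D b) ^ 2 + a * (b * (b * D (D a) - a * D (D b)) - 2 * D b * (b * D a - a * D b)) -
      a ^ 2 * b ^ 2 - b ^ 4 = 0 := by
  have h3 : (3 : F) = 0 := by exact_mod_cast CharP.cast_eq_zero F 3
  simp only [Derivation.smul_apply, smul_eq_mul, Derivation.leibniz, map_add, map_neg, hx, hy]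
    at hidem
  have hI : (D (a / b)) ^ 2 + a / b * D (D (a / b)) - (a / b) ^ 2 - 1 = 0 := by
    have hx' : a / b * x ≠ 0 := mul_ne_zero (div_ne_zero ha0 hb0) hx0
    refine (mul_eq_zero.mp ?_).resolve_left hx'
    linear_combination hidem + ((a / b) ^ 2 * y * D (a / b)) * h3
  have hab : a / b = a * b⁻¹ := div_eq_mul_inv a b
  have hDbinv : D b⁻¹ = -(b⁻¹ * b⁻¹) * D b := by
    rw [Derivation.leibniz_inv, smul_eq_mul, pow_two, neg_mul]
  have hDh : D (a / b) = (b * D a - a * D b) * (b⁻¹ * b⁻¹) := by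
    rw [hab, Derivation.leibniz, hDbinv, smul_eq_mul, smul_eq_mul]
    field_simp
    ring
  have hDDh : D (D (a / b)) =
      (b * (b * D (D a) - a * D (D b)) - 2 * D b * (b * D a - a * D b)) * (b⁻¹ * b⁻¹ * b⁻¹) := by
    rw [hDh]
    simp only [Derivation.leibniz, map_sub, smul_eq_mul, hDbinv]
    field_simp
    ring
  have hII : (b * D a - a * D b) ^ 2 +
      a * (b * (b * D (D a) - a * D (D b)) - 2 * D b * (b * D a - a * D b)) -
      a ^ 2 * b ^ 2 - b ^ 4 =
      b ^ 4 * ((D (a / b)) ^ 2 + a / b * D (D (a / b)) - (a / b) ^ 2 - 1) := by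
    rw [hDDh, hDh, hab]
    field_simp
  rw [hII, hI, mul_zero]

/-- **The constant term of the rescaling identity.** Over a field `k` in which a sum of two
non-zero squares is never zero (e.g. `𝔽₃`), for the rotation operator `f' = -X₁∂₀f + X₀∂₁f` of
`k[X₀, X₁]` (which kills constant terms) and `α(0), β(0) ≠ 0`, the polynomial
`(βα' - αβ')² + α(β(βα'' - αβ'') - 2β'(βα' - αβ')) - α²β² - β⁴` is NON-zero: its constant term is
`-β(0)²(α(0)² + β(0)²)`. [folklore] -/
theorem rotation_identity_ne_zero {k : Type} [Field k]
    (hk : ∀ c d : k, c ≠ 0 → d ≠ 0 → c ^ 2 + d ^ 2 ≠ 0)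
    (α β α₁ α₂ β₁ β₂ : MvPolynomial (Fin 2) k)
    (hα₁ : α₁ = -(X 1 * pderiv 0 α) + X 0 * pderiv 1 α)
    (hα₂ : α₂ = -(X 1 * pderiv 0 α₁) + X 0 * pderiv 1 α₁)
    (hβ₁ : β₁ = -(X 1 * pderiv 0 β) + X 0 * pderiv 1 β)
    (hβ₂ : β₂ = -(X 1 * pderiv 0 β₁) + X 0 * pderiv 1 β₁)
    (hα : constantCoeff α ≠ 0) (hβ : constantCoeff β ≠ 0) :
    (β * α₁ - α * β₁) ^ 2 + α * (β * (β * α₂ - α * β₂) - 2 * β₁ * (β * α₁ - α * β₁)) -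
      α ^ 2 * β ^ 2 - β ^ 4 ≠ 0 := by
  intro h0
  have hIV := congrArg constantCoeff h0
  have hα₁0 : constantCoeff α₁ = 0 := by
    simp only [hα₁, map_add, map_neg, map_mul, constantCoeff_X, zero_mul, neg_zero, add_zero]
  have hα₂0 : constantCoeff α₂ = 0 := by
    simp only [hα₂, map_add, map_neg, map_mul, constantCoeff_X, zero_mul, neg_zero, add_zero]
  have hβ₁0 : constantCoeff β₁ = 0 := by
    simp only [hβ₁, map_add, map_neg, map_mul, constantCoeff_X, zero_mul, neg_zero, add_zero]
  have hβ₂0 : constantCoeff β₂ = 0 := by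
    simp only [hβ₂, map_add, map_neg, map_mul, constantCoeff_X, zero_mul, neg_zero, add_zero]
  simp only [map_sub, map_add, map_mul, map_pow, map_ofNat, map_zero, hα₁0, hα₂0, hβ₁0,
    hβ₂0] at hIV
  -- `hIV : (β₀ * 0 - α₀ * 0) ^ 2 + α₀ * (β₀ * (β₀ * 0 - α₀ * 0) - 2 * 0 * (β₀ * 0 - α₀ * 0))
  --          - α₀ ^ 2 * β₀ ^ 2 - β₀ ^ 4 = 0` (up to `simp`'s bookkeeping)
  have hsum : constantCoeff β ^ 2 * (constantCoeff α ^ 2 + constantCoeff β ^ 2) = 0 := by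
    linear_combination (-1 : k) * hIV
  rcases mul_eq_zero.mp hsum with h | h
  · exact hβ ((pow_eq_zero_iff two_ne_zero).mp h)
  · exact hk _ _ hα hβ h

/-- In `𝔽₃` a sum of two non-zero squares is non-zero (`1 + 1 = 2`). [folklore] -/
theorem zmod_three_sq_add_sq_ne_zero : ∀ c d : ZMod 3, c ≠ 0 → d ≠ 0 → c ^ 2 + d ^ 2 ≠ 0 := by
  decide

/-- **The multiplicative eigenvalue cannot be normalised to `1` by a unit of `S'_c`.** The
strengthening of the multiplicative case of `LogCanQuotLU` "some unit `h` of the local ring `S'_c`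
rescales `g•D` to an idempotent derivation, `((hg)•D)^p = (hg)•D`" (which would turn the twisted
form `G_u` of `μ_p` into `μ_p` itself Zariski-locally) is FALSE — even for SINGULAR multiplicative
points: witness `p = 3`, `𝔽₃[X₀, X₁] ⊆ 𝔽₃(X₀, X₁)`, `O` dominating the origin, the rotation field
`D = -X₁∂₀ + X₀∂₁` (`D³ = -D`, `u = -1`), `g = 1`: `(hD)³ = hD` at `X₁` gives
`(Dh)² + h·D²h - h² = 1`, whose constant term (after clearing the denominator `β⁴` of `h = α/β`)
reads `ᾱ² = -1` in `𝔽₃`, impossible. Any proof of the multiplicative half must therefore treat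
the Galois-twisted toric point (here the non-split `A₂` point `𝔽₃[X₀³, X₁³, X₀² + X₁²]`).
[cite: RudakovShafarevich1976, §1, Thm. 1] -/
theorem multiplicative_unit_normalisation_false :
    ¬ (∀ p : ℕ, p.Prime → ∀ (k K : Type) [Field k] [CharP k p] [PerfectField k] [Field K]
        [Algebra k K] (O : ValuationSubring K) (S' : Subalgebra k K)
        (h' : S'.toSubring ≤ O.toSubring) (D : Derivation k K K) (g : K),
        S'.FG → IsFractionRing S' K →
        IsRegularLocalRing (Localization.AtPrime
          (Ideal.comap (Subring.inclusion h') (IsLocalRing.maximalIdeal O))) →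
        D ≠ 0 → (∃ c : K, ∀ x : K, (⇑D)^[p] x = c * D x) → g ≠ 0 →
        (∀ x : K, (∃ a b : K, a ∈ S' ∧ b ∈ S' ∧ b ≠ 0 ∧ b⁻¹ ∈ O ∧ x = a / b) →
          ∃ a b : K, a ∈ S' ∧ b ∈ S' ∧ b ≠ 0 ∧ b⁻¹ ∈ O ∧ (g • D) x = a / b) →
        (∃ u : K, (∃ a b : K, a ∈ S' ∧ b ∈ S' ∧ b ≠ 0 ∧ b⁻¹ ∈ O ∧ u = a / b) ∧ u ≠ 0 ∧
          u⁻¹ ∈ O ∧ ∀ x : K, (⇑(g • D))^[p] x = u * (g • D) x) →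
        -- (even) at a SINGULAR multiplicative point:
        (∀ x : K, (∃ a b : K, a ∈ S' ∧ b ∈ S' ∧ b ≠ 0 ∧ b⁻¹ ∈ O ∧ x = a / b) →
            (g • D) x ≠ 0 → ((g • D) x)⁻¹ ∉ O) →
        ∃ h : K, (∃ a b : K, a ∈ S' ∧ b ∈ S' ∧ b ≠ 0 ∧ b⁻¹ ∈ O ∧ h = a / b) ∧ h ≠ 0 ∧
          h⁻¹ ∈ O ∧ ∀ x : K, (⇑((h * g) • D))^[p] x = ((h * g) • D) x) := by
  intro H
  classical
  let A : Type := MvPolynomial (Fin 2) (ZMod 3)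
  let K : Type := FractionRing A
  haveI : CharP K 3 := charP_of_injective_algebraMap (algebraMap (ZMod 3) K).injective 3
  have h3 : (3 : K) = 0 := by exact_mod_cast CharP.cast_eq_zero K 3
  have hinj : Function.Injective (algebraMap A K) := IsFractionRing.injective A K
  obtain ⟨O, hO₀, hO₁, hO₂⟩ := exists_valuationSubring_dominating_origin (ZMod 3)
  set S' : Subalgebra (ZMod 3) K := (IsScalarTower.toAlgHom (ZMod 3) A K).range with hS'
  have h' : S'.toSubring ≤ O.toSubring := plane_toSubring_le S' hS' O hO₀
  obtain ⟨D, hD, hDX0, hDX1, hDDD⟩ := exists_rotationDerivation_plane (k := ZMod 3)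
  have hDAK : ∀ a : A, D (algebraMap A K a) =
      algebraMap A K (-(X 1 * pderiv 0 a) + X 0 * pderiv 1 a) := hD
  have hDX0' : D (algebraMap A K (X 0)) = -algebraMap A K (X 1) := hDX0
  have hDX1' : D (algebraMap A K (X 1)) = algebraMap A K (X 0) := hDX1
  -- the crux data: `D` is `3`-closed with `c = -1`, multiplicative with `u = -1`, singular
  have hx₀ : algebraMap A K (X 0) ≠ 0 := (map_ne_zero_iff _ hinj).mpr (X_ne_zero _)
  have hx₁ : algebraMap A K (X 1) ≠ 0 := (map_ne_zero_iff _ hinj).mpr (X_ne_zero _)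
  have hDne : D ≠ 0 := fun h0 => by
    rw [h0, Derivation.zero_apply] at hDX1
    exact hx₀ hDX1.symm
  have hpc : ∃ c : K, ∀ x : K, (⇑D)^[3] x = c * D x :=
    ⟨-1, fun x => by rw [neg_one_mul]; exact hDDD x⟩
  have hD' : ∀ a : A, D (algebraMap A K a) = algebraMap A K
      (((-(X 1 : A)) • (pderiv 0 : Derivation (ZMod 3) A A) + (X 0 : A) • (pderiv 1 : Derivation (ZMod 3) A A)) a) :=
    fun a => by
      rw [hD, Derivation.add_apply, Derivation.smul_apply, Derivation.smul_apply, smul_eq_mul,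
        smul_eq_mul, neg_mul]
  have hpres : ∀ x : K, (∃ a b : K, a ∈ S' ∧ b ∈ S' ∧ b ≠ 0 ∧ b⁻¹ ∈ O ∧ x = a / b) →
      ∃ a b : K, a ∈ S' ∧ b ∈ S' ∧ b ≠ 0 ∧ b⁻¹ ∈ O ∧ ((1 : K) • D) x = a / b := fun x hx => by
    rw [one_smul]
    exact plane_derivation_mapsTo S' hS' O hO₁ hO₂ D _ hD' x hx
  have hm1 : ∃ a b : K, a ∈ S' ∧ b ∈ S' ∧ b ≠ 0 ∧ b⁻¹ ∈ O ∧ (-1 : K) = a / b :=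
    (plane_memSc_iff S' hS' O hO₁ hO₂ _).mpr ⟨-1, 1, by rw [map_one]; exact one_ne_zero,
      by rw [map_neg, map_one, div_one]⟩
  have hmult : ∃ u : K, (∃ a b : K, a ∈ S' ∧ b ∈ S' ∧ b ≠ 0 ∧ b⁻¹ ∈ O ∧ u = a / b) ∧ u ≠ 0 ∧
      u⁻¹ ∈ O ∧ ∀ x : K, (⇑((1 : K) • D))^[3] x = u * ((1 : K) • D) x :=
    ⟨-1, hm1, neg_ne_zero.mpr one_ne_zero, by rw [inv_neg, inv_one]; exact O.neg_mem _ O.one_mem,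
      fun x => by rw [one_smul, neg_one_mul]; exact hDDD x⟩
  have hsing : ∀ x : K, (∃ a b : K, a ∈ S' ∧ b ∈ S' ∧ b ≠ 0 ∧ b⁻¹ ∈ O ∧ x = a / b) →
      ((1 : K) • D) x ≠ 0 → (((1 : K) • D) x)⁻¹ ∉ O := by
    intro x hx hne hinv
    rw [one_smul] at hne hinv
    obtain ⟨α, β, hβ, rfl⟩ := (plane_memSc_iff S' hS' O hO₁ hO₂ x).mp hx
    have hβK : algebraMap A K β ≠ 0 := (map_ne_zero_iff _ hinj).mpr fun h0 =>
      hβ (by rw [h0, map_zero])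
    have hββ : constantCoeff (β * β) ≠ 0 := by
      rw [map_mul]
      exact mul_ne_zero hβ hβ
    set ν : A := β * (-(X 1 * pderiv 0 α) + X 0 * pderiv 1 α) -
      α * (-(X 1 * pderiv 0 β) + X 0 * pderiv 1 β) with hν
    have hDx : D (algebraMap A K α / algebraMap A K β) =
        algebraMap A K ν / algebraMap A K (β * β) := by
      rw [Derivation.leibniz_div, hD, hD, hν, map_sub, map_mul, map_mul, map_mul, smul_eq_mul,
        smul_eq_mul]
      ring
    have hν0 : constantCoeff ν = 0 := by
      simp only [hν, map_sub, map_mul, map_add, map_neg, constantCoeff_X, zero_mul, add_zero,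
        mul_zero, sub_zero, neg_zero]
    have hνK : algebraMap A K ν ≠ 0 := by
      intro h0
      rw [hDx, h0, zero_div] at hne
      exact hne rfl
    have hinv' : (algebraMap A K ν)⁻¹ ∈ O := by
      have hββK : algebraMap A K (β * β) ≠ 0 := by
        rw [map_mul]
        exact mul_ne_zero hβK hβK
      have : (algebraMap A K ν)⁻¹ = (D (algebraMap A K α / algebraMap A K β))⁻¹ *
          (algebraMap A K (β * β))⁻¹ := by
        rw [hDx, inv_div, div_mul_eq_mul_div, mul_inv_cancel₀ hββK, one_div]
      rw [this]
      exact O.mul_mem _ _ hinv (hO₁ _ hββ)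
    exact hνK (by rw [hO₂ ν hν0 hinv', map_zero])
  -- the strengthening, applied
  obtain ⟨h, hmem, hne, hinv, hidem⟩ :=
    H 3 Nat.prime_three (ZMod 3) K O S' h' D 1 (plane_fg S' hS') (plane_isFractionRing S' hS')
      (plane_isRegularLocalRing_centre S' hS' O h') hDne hpc one_ne_zero hpres hmult hsing
  -- `h = α / β` with `α(0), β(0) ≠ 0`
  obtain ⟨α, β, hβ, rfl⟩ := (plane_memSc_iff S' hS' O hO₁ hO₂ h).mp hmem
  set a : K := algebraMap A K α with ha
  set b : K := algebraMap A K β with hb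
  have hb0 : b ≠ 0 := (map_ne_zero_iff _ hinj).mpr fun h0 => hβ (by rw [h0, map_zero])
  have ha0 : a ≠ 0 := fun h0 => hne (by rw [h0, zero_div])
  have hα : constantCoeff α ≠ 0 := by
    intro hcc
    have hainv : a⁻¹ ∈ O := by
      have : a⁻¹ = (a / b)⁻¹ * b⁻¹ := by
        rw [inv_div, div_mul_eq_mul_div, mul_inv_cancel₀ hb0, one_div]
      rw [this]
      exact O.mul_mem _ _ hinv (hO₁ β hβ)
    exact ha0 (by rw [ha, hO₂ α hcc hainv, map_zero])
  -- the identity `(Dh)² + h·D²h - h² = 1` at `X₁`, cleared of denominators …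
  have key := hidem (algebraMap A K (X 1))
  rw [mul_one] at key
  have hII := rescaling_identity_char_three D hDX0' hDX1' hx₀ ha0 hb0 key
  -- … is a polynomial identity in `𝔽₃[X₀, X₁]` with non-zero constant term: contradiction
  rw [ha, hb, hDAK, hDAK, hDAK, hDAK] at hII
  refine rotation_identity_ne_zero zmod_three_sq_add_sq_ne_zero α β _ _ _ _ rfl rfl rfl rfl hα hβ
    ((map_eq_zero_iff _ hinj).mp ?_)
  rw [← hII]
  simp only [map_sub, map_add, map_mul, map_pow, map_neg, map_ofNat]

end Summit.ResolutionOfSingularities.ResolutionOfSingularities.Theorems.LogCanQuotLU.Negative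

end
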